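import Summits.AtomisticToContinuum.Crystallization.Theorems.SquareWellLayerCakeGapTwelveToBarlowCombinatorialLayeringTransportFiniteStar
import Summits.AtomisticToContinuum.Crystallization.Theorems.PalmUnimodularRigidityShellsToBarlowChartTransportGlobalF
import Summits.AtomisticToContinuum.Crystallization.Theorems.PalmUnimodularRigidityShellsToBarlowChartTransportGlobalE
import Summits.AtomisticToContinuum.Crystallization.Theorems.PalmUnimodularRigidityShellsToBarlowChartTransportGlobalD
import Summits.AtomisticToContinuum.Crystallization.Theorems.PalmUnimodularRigidityShellsToBarlowChartTransportGlobalC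
import Summits.AtomisticToContinuum.Crystallization.Theorems.PalmUnimodularRigidityShellsToBarlowChartTransportGlobalA
import Summits.AtomisticToContinuum.Crystallization.Theorems.PalmUnimodularRigidityShellsToBarlowChartTransportGlobalB
import Summits.AtomisticToContinuum.Crystallization.Theorems.PalmUnimodularRigidityShellsToBarlowChartDevelopCovering

/-!
# Combinatorial layering (B1a of `GapTwelveToBarlow`): the finite development read in Barlow model coordinates

Crux `SquareWellLayerCake.GapTwelveToBarlow` (stmt-AtomisticToContinuum-15807), line `Sketch`,
stub `stub_combinatorialLayering`, residual `(H_develop)`; last piece of the FINITE DEVELOPMENT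
(graded analogue of 9227's `…ShellsToBarlowChartDevelopCovering`): the Hägg word
`s k := frameParity (frameAt g₀ k 0 0)` (constant in each covered layer, `par_layerFin`), the
model dictionary `Ψ (barlowPos 1 √(2/3) s k i j) := (frameAt g₀ k i j).pt` (`Function.extend`
along the injective site parametrisation), and, at every covered site, STAR-BIJECTIVITY of `Ψ`
from the model contacts onto the `B`-neighbours and LINK-FAITHFULNESS (`finiteModel`), from
`star_atFin` through `contacts_barlowPos_eq_image` / `dist_relPos_eq_iff_linkAdj`.  All `[folklore]`.
-/

noncomputable section

namespace Summit.AtomisticToContinuum.Crystallization.Theorems.SquareWellLayerCakeGapTwelveToBarlow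

open Literature.Geometry.DiscreteGeometry Literature.MathematicalPhysics.StatisticalMechanics
open Summit.AtomisticToContinuum.Crystallization.Theorems.PalmUnimodularRigidityShellsToBarlowChart hiding
  IsZChart TransportSystem scales_tied sqNormInt_transfer bond_symm nb_mem zlab_spec zlab_nb
  bond_nb_iff pattern_cases transfer_nb_nb transfer_nb_centre transfer_nb_target
  sqNormInt_zlab_centre hcp_of_mirror_pair Istep_spec Jstep_spec IinvStep_spec JinvStep_spec
  capWithAny_of_mem_cap IinvStep_Istep Istep_IinvStep JinvStep_Jstep Jstep_JinvStep polar_at_apex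
  onesided_at_apex Vstep_spec nb_inj Istep_lower Jstep_lower IinvStep_lower JinvStep_lower
  polar_at_lower_apex onesided_at_lower_apex VinvStep_spec attach_I_even attach_I_odd
  attach_lower_I_pos attach_lower_I_neg attach_J_even attach_J_odd Vstep_Istep_pt Vstep_Istep_back
  Vstep_Istep_side Vstep_Jstep_pt Vstep_Istep_comm Vstep_Jstep_comm attach_lower_J_pos
  attach_lower_J_neg VinvStep_Istep_pt VinvStep_Jstep_pt VinvStep_Istep_back VinvStep_Istep_side
  VinvStep_Istep_comm VinvStep_Jstep_comm Istep_Jstep_comm sites par_IJ lowerParity_eq_par_below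
  star_at sites_inlayer up_of_V up_of_Vinv down_of_Vinv down_of_V star_core table_fcc_p table_fcc_m
  table_hcp_p table_hcp_m layers back_I back_J nbhd layer_up layer_down line_I line_J
  adm_transports layer_zero

variable {S : ℕ → Set (EuclideanSpace ℝ (Fin 3))}
  {B : EuclideanSpace ℝ (Fin 3) → EuclideanSpace ℝ (Fin 3) → Prop}
  {Pc : EuclideanSpace ℝ (Fin 3) → Finset (Fin 3 → ℤ)}
  {nb : EuclideanSpace ℝ (Fin 3) → (Fin 3 → ℤ) → EuclideanSpace ℝ (Fin 3)}

variable
  (hch : (∀ n : ℕ, ∀ z ∈ S n, (Pc z = fcc3Int ∨ Pc z = hcpInt) ∧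
      Set.BijOn (nb z) (↑(Pc z) : Set (Fin 3 → ℤ)) {y | B z y} ∧
      ∀ t ∈ Pc z, ∀ t' ∈ Pc z, (B (nb z t) (nb z t') ↔ sqNormInt (t - t') = 18)) ∧
    (∀ n : ℕ, ∀ z ∈ S (n + 1), ∀ y, B z y → y ∈ S n) ∧
    (∀ n m : ℕ, ∀ x ∈ S n, ∀ y ∈ S m, B x y →
      ∀ (z z' : EuclideanSpace ℝ (Fin 3)) (t t' u u' : Fin 3 → ℤ),
        (t = 0 ∧ z = x ∨ t ∈ Pc x ∧ z = nb x t) → (t' = 0 ∧ z' = x ∨ t' ∈ Pc x ∧ z' = nb x t') →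
        (u = 0 ∧ z = y ∨ u ∈ Pc y ∧ z = nb y u) → (u' = 0 ∧ z' = y ∨ u' ∈ Pc y ∧ z' = nb y u') →
        sqNormInt (u - u') = sqNormInt (t - t')) ∧
    (∀ x y, B x y → B y x))

include hch



open Summit.AtomisticToContinuum.Crystallization.Theorems.PalmUnimodularRigidityShellsToBarlowChart.DevelopCovering

/-! ## Parity is constant in each covered layer -/

/-- Parity of the frame `(k, i, j)` equals the parity of `(k, 0, 0)` on the covered part of layer
`k`. [folklore] -/
theorem par_layerFin {n K R : ℕ} {g₀ : ZFrame} (h₀ : IsFrame (Pc g₀.pt) g₀.t₁ g₀.t₂ g₀.U)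
    (h₀S : g₀.pt ∈ S (n + K + 4 + R)) (h₀p : frameParity g₀.t₁ g₀.t₂ g₀.U = 1)
    (h₀A : (∀ m, ∀ z ∈ S m, Pc z = fcc3Int) ∨ Pc g₀.pt = hcpInt) (hKR : 3 * K ≤ R)
    (k : ℤ) (hk : k.natAbs ≤ K) :
    ∀ i j : ℤ, j.natAbs + i.natAbs + 3 * k.natAbs + 4 ≤ R →
      frameParity (frameAt Pc nb g₀ k i j).t₁ (frameAt Pc nb g₀ k i j).t₂ (frameAt Pc nb g₀ k i j).U = frameParity (frameAt Pc nb g₀ k 0 0).t₁ (frameAt Pc nb g₀ k 0 0).t₂ (frameAt Pc nb g₀ k 0 0).U := by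
  have PIJ := fun i j (h : j.natAbs + i.natAbs + 3 * k.natAbs + 4 ≤ R) =>
    par_IJFin hch h₀ h₀S h₀p h₀A hKR k i j hk h
  -- along `J` at `i = 0`
  have colJ : ∀ j : ℤ, j.natAbs + 3 * k.natAbs + 4 ≤ R →
      frameParity (frameAt Pc nb g₀ k 0 j).t₁ (frameAt Pc nb g₀ k 0 j).t₂ (frameAt Pc nb g₀ k 0 j).U = frameParity (frameAt Pc nb g₀ k 0 0).t₁ (frameAt Pc nb g₀ k 0 0).t₂ (frameAt Pc nb g₀ k 0 0).U := by
    intro j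
    induction j using Int.induction_on with
    | zero => intro _; rfl
    | succ m ih =>
      intro hm
      rw [← ih (by omega)]
      exact (PIJ 0 (m : ℤ) (by simp only [Int.natAbs_zero]; omega)).2
    | pred m ih =>
      intro hm
      rw [← ih (by omega)]
      have := (PIJ 0 (-(m : ℤ) - 1) (by simp only [Int.natAbs_zero]; omega)).2
      rw [sub_add_cancel] at this
      exact this.symm
  intro i
  induction i using Int.induction_on with
  | zero => intro j h; exact colJ j (by simpa using h)
  | succ m ih =>
    intro j hm
    rw [← ih j (by omega)]
    exact (PIJ (m : ℤ) j (by omega)).1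
  | pred m ih =>
    intro j hm
    rw [← ih j (by omega)]
    have := (PIJ (-(m : ℤ) - 1) j (by omega)).1
    rw [sub_add_cancel] at this
    exact this.symm

/-! ## The model dictionary -/

/-- **The finite development in model coordinates.**  With the Hägg word
`s k := frameParity (frameAt g₀ k 0 0)` there is a map `Ψ` with
`Ψ (barlowPos 1 √(2/3) s k i j) = (frameAt g₀ k i j).pt` which, at every covered site
(`|k| + 1 ≤ K`, `|j| + |i| + 3(|k| + 1) + 4 ≤ R`), maps the model contacts bijectively onto the
`B`-neighbours and reads bonds among them faithfully. [folklore] -/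
theorem finiteModel {n K R : ℕ} {g₀ : ZFrame} (h₀ : IsFrame (Pc g₀.pt) g₀.t₁ g₀.t₂ g₀.U)
    (h₀S : g₀.pt ∈ S (n + K + 4 + R)) (h₀p : frameParity g₀.t₁ g₀.t₂ g₀.U = 1)
    (h₀A : (∀ m, ∀ z ∈ S m, Pc z = fcc3Int) ∨ Pc g₀.pt = hcpInt) (hKR : 3 * K ≤ R) :
    ∃ s : ℤ → ℤ, IsHaggSeq s ∧ (∀ k : ℤ, s k = frameParity (frameAt Pc nb g₀ k 0 0).t₁ (frameAt Pc nb g₀ k 0 0).t₂ (frameAt Pc nb g₀ k 0 0).U) ∧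
      ∃ Ψ : EuclideanSpace ℝ (Fin 3) → EuclideanSpace ℝ (Fin 3),
        (∀ k i j : ℤ, Ψ (barlowPos 1 (Real.sqrt (2 / 3)) s k i j) = (frameAt Pc nb g₀ k i j).pt) ∧
        ∀ k i j : ℤ, k.natAbs + 1 ≤ K → j.natAbs + i.natAbs + 3 * (k.natAbs + 1) + 4 ≤ R →
          Set.BijOn Ψ (contacts s (barlowPos 1 (Real.sqrt (2 / 3)) s k i j))
              (fun z => B (frameAt Pc nb g₀ k i j).pt z) ∧
            ∀ q ∈ contacts s (barlowPos 1 (Real.sqrt (2 / 3)) s k i j),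
              ∀ q' ∈ contacts s (barlowPos 1 (Real.sqrt (2 / 3)) s k i j),
                (B (Ψ q) (Ψ q') ↔ dist q q' = 1) := by
  set s : ℤ → ℤ := fun k => frameParity (frameAt Pc nb g₀ k 0 0).t₁ (frameAt Pc nb g₀ k 0 0).t₂ (frameAt Pc nb g₀ k 0 0).U with hs_def
  have hs : IsHaggSeq s := fun k => frameParity_eq_or _ _ _
  have hinj := barlowPos_triple_injective one_pos (Real.sqrt_pos.2 (by norm_num : (0 : ℝ) < 2 / 3)) s
  refine ⟨s, hs, fun k => rfl, Function.extend (fun t : ℤ × ℤ × ℤ => barlowPos 1 (Real.sqrt (2 / 3)) s t.1 t.2.1 t.2.2)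
    (fun t => (frameAt Pc nb g₀ t.1 t.2.1 t.2.2).pt) (fun _ => 0), ?_, ?_⟩
  · intro k i j
    exact hinj.extend_apply _ _ (k, i, j)
  intro k i j hk hij
  set Ψ := Function.extend (fun t : ℤ × ℤ × ℤ => barlowPos 1 (Real.sqrt (2 / 3)) s t.1 t.2.1 t.2.2)
    (fun t => (frameAt Pc nb g₀ t.1 t.2.1 t.2.2).pt) (fun _ => (0 : EuclideanSpace ℝ (Fin 3))) with hΨ_def
  have hΨ : ∀ k i j : ℤ, Ψ (barlowPos 1 (Real.sqrt (2 / 3)) s k i j) = (frameAt Pc nb g₀ k i j).pt :=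
    fun k i j => hinj.extend_apply _ _ (k, i, j)
  have hG : ∀ y : ℤ × ℤ × ℤ, Ψ (relPos 1 (Real.sqrt (2 / 3)) s k i j y) =
      (frameAt Pc nb g₀ (k + y.1) (i - y.2.1) (j - y.2.2)).pt := fun y => by
    rw [relPos_eq_barlowPos, hΨ]
  -- the frame at the centre and its two letters
  rcases h : frameAt Pc nb g₀ k i j with ⟨x, t₁, t₂, U⟩
  have hσp : frameParity t₁ t₂ U = s k := by
    have := par_layerFin hch h₀ h₀S h₀p h₀A hKR k (by omega) i j (by omega)
    rw [h] at this; exact this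
  have hσm : lowerParity t₁ t₂ (lowerCap (Pc x) t₁ t₂ U) = s (k - 1) := by
    have e1 := lowerParityFin_eq_par_below hch h₀ h₀S h₀p h₀A hKR k (by omega) (by omega) i j (by omega) (by omega)
    rw [h] at e1
    have e2 := par_layerFin hch h₀ h₀S h₀p h₀A hKR (k - 1) (by omega) i j (by omega)
    exact e1.trans e2
  obtain ⟨hB, hL⟩ := star_atFin hch h₀ h₀S h₀p h₀A hKR k i j hk hij h hσp hσm
  rw [contacts_barlowPos_eq_image hs]
  refine ⟨⟨?_, ?_, ?_⟩, ?_⟩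
  · rintro _ ⟨y, hy, rfl⟩
    show B x (Ψ _)
    rw [hG]; exact hB.1 hy
  · rintro _ ⟨y, hy, rfl⟩ _ ⟨y', hy', rfl⟩ hyy
    rw [hG, hG] at hyy
    rw [hB.2.1 hy hy' hyy]
  · intro w hw
    obtain ⟨y, hy, hGy⟩ := hB.2.2 hw
    exact ⟨relPos 1 (Real.sqrt (2 / 3)) s k i j y, ⟨y, hy, rfl⟩, by rw [hG]; exact hGy⟩
  · rintro _ ⟨y, hy, rfl⟩ _ ⟨y', hy', rfl⟩
    rw [Finset.mem_coe] at hy hy'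
    rw [dist_relPos_eq_iff_linkAdj hs one_pos ShellsToBarlowChartNegative.sqrt_two_thirds_sq k i j
      (fst_mem_of_mem_linkOffsets hy) (fst_mem_of_mem_linkOffsets hy'), hG, hG]
    exact hL y hy y' hy'

/-! ## Registered anchor (closed form) -/

omit hch in
/-- **Closed form of `par_layerFin`** (the registered anchor of this file): the section data
`S, B, Pc, nb` and the standing hypothesis written out (two hypotheses regrouped). [folklore] -/
theorem par_layerFin_graded :
    ∀ {S : ℕ → Set (EuclideanSpace ℝ (Fin 3))} {B : EuclideanSpace ℝ (Fin 3) → EuclideanSpace ℝ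
    (Fin 3) → Prop} {Pc : EuclideanSpace ℝ (Fin 3) → Finset (Fin 3 → ℤ)} {nb : EuclideanSpace ℝ
    (Fin 3) → (Fin 3 → ℤ) → EuclideanSpace ℝ (Fin 3)}, ((∀ n : ℕ, ∀ z ∈ S n, (Pc z =
    Summit.AtomisticToContinuum.Crystallization.Theorems.PalmUnimodularRigidityShellsToBarlowChart.fcc3Int
    ∨ Pc z = Literature.Geometry.DiscreteGeometry.hcpInt) ∧ Set.BijOn (nb z) (↑(Pc z) : Set (Fin
    3 → ℤ)) {y | B z y} ∧ ∀ t ∈ Pc z, ∀ t' ∈ Pc z, (B (nb z t) (nb z t') ↔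
    Literature.Geometry.DiscreteGeometry.sqNormInt (t - t') = 18)) ∧ (∀ n : ℕ, ∀ z ∈ S (n + 1),
    ∀ y, B z y → y ∈ S n) ∧ (∀ n m : ℕ, ∀ x ∈ S n, ∀ y ∈ S m, B x y → ∀ (z z' : EuclideanSpace ℝ
    (Fin 3)) (t t' u u' : Fin 3 → ℤ), (t = 0 ∧ z = x ∨ t ∈ Pc x ∧ z = nb x t) → (t' = 0 ∧ z' = x
    ∨ t' ∈ Pc x ∧ z' = nb x t') → (u = 0 ∧ z = y ∨ u ∈ Pc y ∧ z = nb y u) → (u' = 0 ∧ z' = y ∨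
    u' ∈ Pc y ∧ z' = nb y u') → Literature.Geometry.DiscreteGeometry.sqNormInt (u - u') =
    Literature.Geometry.DiscreteGeometry.sqNormInt (t - t')) ∧ (∀ x y, B x y → B y x)) → ∀ {n K
    R : ℕ} {g₀ :
    Summit.AtomisticToContinuum.Crystallization.Theorems.PalmUnimodularRigidityShellsToBarlowChart.ZFrame}
    (k : ℤ), g₀.pt ∈ S (n + K + 4 + R) →
    Summit.AtomisticToContinuum.Crystallization.Theorems.PalmUnimodularRigidityShellsToBarlowChart.IsFrame
    (Pc g₀.pt) g₀.t₁ g₀.t₂ g₀.U →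
    Summit.AtomisticToContinuum.Crystallization.Theorems.PalmUnimodularRigidityShellsToBarlowChart.frameParity
    g₀.t₁ g₀.t₂ g₀.U = 1 → (∀ m, ∀ z ∈ S m, Pc z =
    Summit.AtomisticToContinuum.Crystallization.Theorems.PalmUnimodularRigidityShellsToBarlowChart.fcc3Int)
    ∨ Pc g₀.pt = Literature.Geometry.DiscreteGeometry.hcpInt → 3 * K ≤ R → k.natAbs ≤ K → ∀ i j
    : ℤ, j.natAbs + i.natAbs + 3 * k.natAbs + 4 ≤ R →
    Summit.AtomisticToContinuum.Crystallization.Theorems.PalmUnimodularRigidityShellsToBarlowChart.frameParity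
    (frameAt Pc nb g₀ k i j).t₁ (frameAt Pc nb g₀ k i j).t₂ (frameAt Pc nb g₀ k i j).U =
    Summit.AtomisticToContinuum.Crystallization.Theorems.PalmUnimodularRigidityShellsToBarlowChart.frameParity
    (frameAt Pc nb g₀ k 0 0).t₁ (frameAt Pc nb g₀ k 0 0).t₂ (frameAt Pc nb g₀ k 0 0).U := by
  intro S B Pc nb hch n K R g₀ k h₀S h₀ h₀p h₀A hKR hk
  exact par_layerFin hch h₀ h₀S h₀p h₀A hKR k hk

end Summit.AtomisticToContinuum.Crystallization.Theorems.SquareWellLayerCakeGapTwelveToBarlow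

end
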